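import Literature.Analysis.FluidPDE.LocalLeraySolutions
import Literature.Analysis.FluidPDE.SelfSimilar
import Literature.Analysis.UnboundedOperators.HeatKernel
import HarnessLib

/-!
# Jia–Šverák 2014: the a-priori estimate for forward self-similar Leray solutions, typed verbatim

Statement-level reproduction of H. Jia, V. Šverák, *Local-in-space estimates near initial time for weak
solutions of the Navier–Stokes equations and forward self-similar solutions*, Invent. Math. 196 (2014)
233–265 (arXiv:1204.0529; TeX line numbers below refer to the arXiv source `main.tex`, page numbers to the
arXiv PDF) [JiaSverak2014] — the PUBLISHED theorem that upgrades a forward self-similar Leray solution with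
smooth `−1`-homogeneous datum to a smooth profile with the sharp `(1+|x|)^{−3−|α|}` decay of `U − e^Δu₀`
(§4, arXiv "Theorem 6", TeX L753–760 = Invent. Math. Thm. 4.1). Recorded by cell pub-nsjs
(papers/NavierStokesRegularity/ns-jia-sverak) because it is the published input behind the "elliptic
bootstrap" step of Ionescu–Jia–Palasek 2026 §3 Step 1 (arXiv:2606.07501, (pot15.001)); the bridge from
IJP26's profile hypotheses to JS14's Leray class is the cell's own Lemma A (LEMMA-A.md), typed here ONLY as
the hypothesis structure `LemmaA` (a claim under audit, never a fact).

## Setting of JS14 §4 (TeX L746–751), verbatim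
"Let `u` be a Leray solution with initial data `u₀`. Suppose `λ u₀(λx) = u₀(x)`, `λ u(λx, λ²t) = u(x,t)` for
any `λ > 0`. We also assume `u₀|_{∂B₁(0)} ∈ C^∞(∂B₁(0))`."

## Theorem 6 (A-priori estimate for forward self similar solutions; TeX L753–760, PDF p.9), verbatim
"Let `u`, `u₀` be as in the above. Then `U(·) := u(·,1)`, the solution profile at time `t = 1`, belongs to
`C^∞(ℝ³)` and `|∂^α(U(x) − e^Δu₀(x))| ≤ C(α,u₀) / (1+|x|)^{3+|α|}, ∀ |α| ≥ 0`."

## Definition (Leray solution; TeX L576–603, PDF p.6), what is reused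
"A vector field `u ∈ L²_loc(ℝ³ × [0,∞))` is called a Leray solution to Navier–Stokes equations with initial
data `u₀` if it satisfies: i) `ess sup_{0≤t<R²} sup_{x₀} ∫_{B_R(x₀)} |u|²/2 + sup_{x₀} ∫₀^{R²}∫_{B_R(x₀)} |∇u|² < ∞`,
and `lim_{|x₀|→∞} ∫₀^{R²}∫_{B_R(x₀)} |u|² = 0`, for any `R < ∞`. ii) for some distribution `p` in
`ℝ³ × (0,∞)`, `(u,p)` verifies Navier–Stokes equations in the sense of distributions and for any compact set
`K ⊆ ℝ³`, `lim_{t→0+} ‖u(·,t) − u₀‖_{L²(K)} = 0`. iii) `u` is suitable in the sense of Caffarelli–Kohn–Nirenberg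
[local energy inequality (eq:no2)]. The set of all Leray solutions starting from `u₀` will be denoted as
`𝒩(u₀)`." This class is ALREADY in the tree as `Literature.Analysis.FluidPDE.IsLocalLeraySolution 1 u₀ u p`
(`LocalLeraySolutions.lean`, docstring "= JiaSverak2014 §3"; the KMT Def. 3.2 rendering with `L²_loc` /
`L^{3/2}_loc` up to `t = 0`, which JS14's `u ∈ L²_loc(ℝ³ × [0,∞))` and the suitable-pressure clause also
demand); it is used here verbatim, not re-declared.

## What the typing keeps and drops
* `IsHomogeneousDatum u₀` = "`λ u₀(λx) = u₀(x)`" + "`u₀|_{∂B₁} ∈ C^∞`" (typed as `C^∞` off `0`, which for a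
  `−1`-homogeneous field is the same thing) + `div u₀ = 0` off `0` (the standing §3 assumption
  "`u₀ ∈ L²_loc`, `div u₀ = 0`, `sup_{x₀} ∫_{B_1(x₀)} |u₀|² < ∞`", TeX L575: the two integrability clauses follow
  from `|u₀(x)| ≤ C/|x|`; the distributional `div u₀ = 0` on all of `ℝ³` follows from the classical one off
  `0` because a distribution supported at `0` that is homogeneous of degree `−2` vanishes). Typed
  hypotheses ⊆ printed.
* Scale invariance "`λ u(λx, λ²t) = u(x,t)`" is the tree's `IsSelfSimilar u` (`nsRescale c u = u`, `c > 0`).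
* `e^Δu₀` is the tree's caloric extension `UnboundedOperators.heatExtension u₀ 1` (`HeatKernel.lean`;
  absolutely convergent since `|u₀| ≤ C/|x|`).
* `ProfileDecay u₀ U` = the conclusion, all orders `n = |α|`, with `iteratedFDeriv ℝ n` and the natural-number
  power `(1 + ‖x‖)^(3+n)` (no junk value).
* The self-similar lift `t^{−1/2} U(x/√t)`, `t⁻¹ P(x/√t)` is the tree's `lerayForward (1/2) U`,
  `lerayForwardPressure (1/2) P` (`2·(1/2)·t = t`), and JS14's profile system (TeX L794–799)
  `−ΔU − ½U − ½x·∇U + U·∇U + ∇P = 0`, `div U = 0` is the tree's `IsForwardProfile 1 (1/2) U P`.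

## What is deliberately NOT here
* No proof of Theorem 6 (JS14 §4: the singularly forced Stokes lemma TeX L806–830 and the bootstrap) — it is
  a named fact, consumed as an explicit hypothesis `(hT : Thm6)`.
* `LemmaA` is NOT a fact: it is the cell's pen-and-paper bridge (LEMMA-A.md, gen 5: Galilean-shifted
  Caccioppoli identity on unit parabolic cylinders + off-support pressure representation), NOT in print and
  NOT kernel-checked; it is a claim-tagged hypothesis structure in the tree's style for unrefereed material
  (`IonescuJiaPalasek2026/Statements.lean` `Thm12`). `decay_of_thm6_lemmaA` records exactly what is
  consumed: `Thm6` (published) and `LemmaA` (claim).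

## References
* H. Jia, V. Šverák, Invent. Math. 196 (2014) 233–265 = arXiv:1204.0529: §3 Definition (Leray solution,
  TeX L576–603, p.6); §4 setting (TeX L746–751) and Theorem 6 (TeX L753–760, p.9). [JiaSverak2014]
* A. D. Ionescu, H. Jia, S. Palasek, arXiv:2606.07501 (2026): Thm. 1.2 p.4 (the profile hypotheses read
  by `ProfileHyp`), §3 Step 1 (pot15.001) (the use of the bootstrap). [IonescuJiaPalasek2026]
-/

open MeasureTheory Set
open scoped ENNReal Laplacian InnerProductSpace

namespace Literature.Analysis.FluidPDE.JiaSverak2014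

open UnboundedOperators

/-- File-local notation, identical to `JiaSverak2015/Statements.lean`. -/
local notation "ℝ³" => EuclideanSpace ℝ (Fin 3)

/-- **JS14 §4 datum** (TeX L746–751; §3 setting TeX L575): `u₀` is `−1`-homogeneous
("`λ u₀(λx) = u₀(x)` for any `λ > 0`"), smooth away from the origin ("`u₀|_{∂B₁(0)} ∈ C^∞(∂B₁(0))`", equivalent
under homogeneity), and divergence free away from the origin ("`div u₀ = 0`"; see the module docstring for
the distributional reading). [cite: JiaSverak2014, §4 TeX L746–751] -/
structure IsHomogeneousDatum (u₀ : ℝ³ → ℝ³) : Prop where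
  /-- "`λ u₀(λx) = u₀(x)` for any `λ > 0`". -/
  homogeneous : ∀ c : ℝ, 0 < c → ∀ x : ℝ³, c • u₀ (c • x) = u₀ x
  /-- "`u₀|_{∂B₁(0)} ∈ C^∞(∂B₁(0))`", read as `C^∞` on `ℝ³ ∖ {0}`. -/
  smooth_off_zero : ContDiffOn ℝ (⊤ : ℕ∞) u₀ ({0}ᶜ : Set ℝ³)
  /-- "`div u₀ = 0`" (§3 setting), classically on `ℝ³ ∖ {0}`. -/
  divFree_off_zero : ∀ x : ℝ³, x ≠ 0 → VectorCalculus.divergence u₀ x = 0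

/-- **The conclusion of JS14 Theorem 6** for a profile `U` and datum `u₀`: "`U ∈ C^∞(ℝ³)` and
`|∂^α(U(x) − e^Δu₀(x))| ≤ C(α,u₀)/(1+|x|)^{3+|α|}, ∀ |α| ≥ 0`" — all orders `n`, the derivative as
`iteratedFDeriv ℝ n`, `e^Δu₀` as the tree's `heatExtension u₀ 1`. [cite: JiaSverak2014, Thm. 6 TeX L753–760] -/
def ProfileDecay (u₀ U : ℝ³ → ℝ³) : Prop :=
  ContDiff ℝ (⊤ : ℕ∞) U ∧
    ∀ n : ℕ, ∃ C : ℝ, ∀ x : ℝ³,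
      ‖iteratedFDeriv ℝ n (fun y => U y - heatExtension u₀ 1 y) x‖ ≤ C / (1 + ‖x‖) ^ (3 + n)

/-- **JS14 Theorem 6** (A-priori estimate for forward self similar solutions; TeX L753–760, PDF p.9;
Invent. Math. Thm. 4.1) as a named fact: for a Leray solution `u ∈ 𝒩(u₀)` (`IsLocalLeraySolution 1 u₀ u p`)
which is scale invariant (`IsSelfSimilar u`) with a `−1`-homogeneous datum smooth on the unit sphere
(`IsHomogeneousDatum u₀`), the profile `U := u(·,1)` is `C^∞` with `|∂^α(U − e^Δu₀)| ≤ C(α,u₀)(1+|x|)^{−3−|α|}`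
for all `α`. Consumed as an explicit hypothesis, never instantiated here. [cite: JiaSverak2014, Thm. 6 TeX L753–760] -/
structure Thm6 : Prop where
  /-- The theorem, verbatim, over the tree's Leray class. -/
  profile : ∀ (u₀ : ℝ³ → ℝ³) (u : ℝ → ℝ³ → ℝ³) (p : ℝ → ℝ³ → ℝ),
    IsHomogeneousDatum u₀ → IsLocalLeraySolution 1 u₀ u p → IsSelfSimilar u →
      ProfileDecay u₀ (fun x => u 1 x)

/-- **The profile hypotheses of IJP26 Thm. 1.2** (arXiv:2606.07501 p.4, (pr7) TeX L181–185) on `(U₀, U, P)`, in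
JS14's form (TeX L794–799): `U₀` a JS14 datum; `(U, P)` a classical forward profile
`−ΔU − ½U − ½x·∇U + U·∇U + ∇P = 0`, `div U = 0` (`IsForwardProfile 1 (1/2)`, JS sign); the pressure in some
`L^q(ℝ³)`, `3/2 < q < ∞` (the reading of the Leray projection `Π` as the Riesz-transform pressure — any two
such pressures differ by a harmonic `L^q` function, i.e. by `0`); and the closeness "`|U(x) − U₀(x)| ≲ ⟨x⟩⁻²`",
`⟨x⟩² = 1 + |x|²`, READ FOR `|x| ≥ 1` (DIVERGENCE D13): the printed clause is stated for all `x`, but a `C²`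
(hence locally bounded) `U` and a `−1`-homogeneous `U₀` satisfy it near the origin only if `U₀ ≡ 0` off `0`
(`ProfileHypLiteral.datum_eq_zero_of_ne` below, kernel-checked), so the literal reading empties IJP26 Thm. 1.2
of every non-trivial datum; the far-field reading is the one every use in IJP26 §3 and in LEMMA-A.md (1.1)
makes. `ProfileHyp` is the far-field reading; `ProfileHypLiteral` records the printed one. These are the
hypotheses H-U1–H-U4 of LEMMA-A.md. [cite: IonescuJiaPalasek2026, Thm. 1.2 p.4] -/
structure ProfileHyp (U₀ U : ℝ³ → ℝ³) (P : ℝ³ → ℝ) : Prop where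
  /-- `U₀ ∈ C^∞(ℝ³ ∖ {0})`, divergence free, `−1`-homogeneous. -/
  datum : IsHomogeneousDatum U₀
  /-- The profile system, classical (`U ∈ C²`, `P ∈ C¹`). -/
  profile : IsForwardProfile 1 (1 / 2) U P
  /-- `P ∈ L^q(ℝ³)` for some `3/2 < q < ∞`. -/
  pressure_Lq : ∃ q : ℝ≥0∞, 3 / 2 < q ∧ q < (⊤ : ℝ≥0∞) ∧ MemLp P q volume
  /-- "`|U(x) − U₀(x)| ≲ ⟨x⟩⁻²`" for `|x| ≥ 1` (far-field reading, D13). -/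
  close : ∃ C : ℝ, ∀ x : ℝ³, 1 ≤ ‖x‖ → ‖U x - U₀ x‖ ≤ C / (1 + ‖x‖ ^ 2)

/-- **The printed form of the closeness clause** (IJP26 (pr7), "for all `x`"): identical to `ProfileHyp` except
that `close` is asked for every `x ≠ 0`. Kept ONLY as the record of DIVERGENCE D13 — it is degenerate
(`datum_eq_zero_of_ne`). Never consume it. [cite: IonescuJiaPalasek2026, Thm. 1.2 p.4] -/
structure ProfileHypLiteral (U₀ U : ℝ³ → ℝ³) (P : ℝ³ → ℝ) : Prop where
  datum : IsHomogeneousDatum U₀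
  profile : IsForwardProfile 1 (1 / 2) U P
  pressure_Lq : ∃ q : ℝ≥0∞, 3 / 2 < q ∧ q < (⊤ : ℝ≥0∞) ∧ MemLp P q volume
  /-- "`|U(x) − U₀(x)| ≲ ⟨x⟩⁻²`" for ALL `x ≠ 0` — the printed clause. -/
  close : ∃ C : ℝ, ∀ x : ℝ³, x ≠ 0 → ‖U x - U₀ x‖ ≤ C / (1 + ‖x‖ ^ 2)

/-- The printed reading implies the far-field reading (trivially: `1 ≤ ‖x‖ → x ≠ 0`). [folklore] -/
theorem ProfileHyp.of_literal {U₀ U : ℝ³ → ℝ³} {P : ℝ³ → ℝ} (h : ProfileHypLiteral U₀ U P) :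
    ProfileHyp U₀ U P where
  datum := h.datum
  profile := h.profile
  pressure_Lq := h.pressure_Lq
  close := by
    obtain ⟨C, hC⟩ := h.close
    exact ⟨C, fun x hx => hC x (by rintro rfl; simp at hx; linarith)⟩

/-- **DIVERGENCE D13, kernel-checked.** Under the PRINTED closeness clause the datum vanishes off the origin:
a `C²` profile is bounded on `B̄₁`, so `|U₀(cω)| ≤ M + |C|` for `0 < c ≤ 1`, `|ω| = 1`, while
`−1`-homogeneity gives `|U₀(ω)| = c|U₀(cω)| ≤ c(M + |C|) → 0`; homogeneity then transports the sphere to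
every ray. Hence IJP26 Thm. 1.2 with (pr7) read literally has no instance with a non-zero datum, and every
consumer of `ProfileHypLiteral` (none in the tree) would be vacuous for `σ a₀`. [folklore] -/
theorem ProfileHypLiteral.datum_eq_zero_of_ne {U₀ U : ℝ³ → ℝ³} {P : ℝ³ → ℝ}
    (h : ProfileHypLiteral U₀ U P) : ∀ x : ℝ³, x ≠ 0 → U₀ x = 0 := by
  obtain ⟨C, hC⟩ := h.close
  have hcont : Continuous U := h.profile.contDiff_velocity.continuous
  obtain ⟨M, hM⟩ := (isCompact_closedBall (0 : ℝ³) 1).exists_bound_of_continuousOn hcont.continuousOn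
  have hsphere : ∀ ω : ℝ³, ‖ω‖ = 1 → U₀ ω = 0 := by
    intro ω hω
    have key : ∀ c : ℝ, 0 < c → c ≤ 1 → ‖U₀ ω‖ ≤ c * (M + |C|) := by
      intro c hc hc1
      have hne : c • ω ≠ 0 := by
        intro h0
        have := congrArg norm h0
        simp [norm_smul, hω, abs_of_pos hc] at this
        exact hc.ne' this
      have h1 := hC (c • ω) hne
      have hball : c • ω ∈ Metric.closedBall (0 : ℝ³) 1 := by
        simp [norm_smul, hω, abs_of_pos hc, hc1]
      have h2 := hM (c • ω) hball
      have hden : (0 : ℝ) < 1 + ‖c • ω‖ ^ 2 := by positivity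
      have h3 : C / (1 + ‖c • ω‖ ^ 2) ≤ |C| := by
        calc C / (1 + ‖c • ω‖ ^ 2) ≤ |C| / (1 + ‖c • ω‖ ^ 2) :=
              div_le_div_of_nonneg_right (le_abs_self C) hden.le
          _ ≤ |C| / 1 := div_le_div_of_nonneg_left (abs_nonneg C) one_pos (by linarith [sq_nonneg ‖c • ω‖])
          _ = |C| := div_one _
      have hhom := h.datum.homogeneous c hc ω
      have h4 : ‖U₀ ω‖ = c * ‖U₀ (c • ω)‖ := by
        rw [← hhom, norm_smul, Real.norm_eq_abs, abs_of_pos hc]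
      have h5 : ‖U₀ (c • ω)‖ ≤ M + |C| := by
        calc ‖U₀ (c • ω)‖ = ‖U (c • ω) - (U (c • ω) - U₀ (c • ω))‖ := by congr 1; abel
          _ ≤ ‖U (c • ω)‖ + ‖U (c • ω) - U₀ (c • ω)‖ := norm_sub_le _ _
          _ ≤ M + |C| := add_le_add h2 (h1.trans h3)
      rw [h4]
      exact mul_le_mul_of_nonneg_left h5 hc.le
    have hM0 : 0 ≤ M + |C| := by
      have h1 := hM ω (by simp [hω]); have h2 := norm_nonneg (U ω); have h3 := abs_nonneg C; linarith
    have hle : ‖U₀ ω‖ ≤ 0 := by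
      apply le_of_forall_pos_le_add
      intro ε hε
      set c : ℝ := min 1 (ε / (M + |C| + 1)) with hcdef
      have hcpos : 0 < c := lt_min one_pos (by positivity)
      have hc1 : c ≤ 1 := min_le_left _ _
      have hc2 : c ≤ ε / (M + |C| + 1) := min_le_right _ _
      calc ‖U₀ ω‖ ≤ c * (M + |C|) := key c hcpos hc1
        _ ≤ (ε / (M + |C| + 1)) * (M + |C| + 1) := by
            apply mul_le_mul hc2 (by linarith) hM0 (by positivity)
        _ = ε := by field_simp
        _ = 0 + ε := by ring
    exact norm_le_zero_iff.mp hle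
  intro x hx
  have hnx : 0 < ‖x‖ := norm_pos_iff.mpr hx
  have hω : ‖(‖x‖⁻¹ • x)‖ = 1 := by
    rw [norm_smul, norm_inv, norm_norm, inv_mul_cancel₀ hnx.ne']
  have hhom := h.datum.homogeneous (‖x‖⁻¹) (inv_pos.mpr hnx) x
  rw [← hhom, hsphere _ hω, smul_zero]

/-- **Lemma A of cell pub-nsjs (LEMMA-A.md, gen 5) — a CLAIM, not a fact.** Under `ProfileHyp U₀ U P` the
self-similar lift `u(x,t) = t^{−1/2}U(x/√t)`, `p(x,t) = t⁻¹P(x/√t)` is a Leray solution with datum `U₀` in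
JS14's sense (`u ∈ 𝒩(U₀)`). Pen-and-paper proof in LEMMA-A.md §3 (Galilean-shifted local energy identity on
unit parabolic cylinders, off-support pressure representation, dyadic summation); NOT in print, NOT
kernel-checked; hence a hypothesis STRUCTURE — never an instance, never an axiom; consumers take `(hA : LemmaA)`
explicitly. Status: a cell-internal lemma (LEMMA-A.md) under audit by the cell's referees, filed under the tree's
claim tag for unrefereed material. It is the bridge IJP26 §3 Step 1 leaves to "standard elliptic bootstrapping arguments (similar
to [JiSv1, §4])". [claim: IonescuJiaPalasek2026, status: under-review] -/
structure LemmaA : Prop where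
  /-- `u ∈ 𝒩(U₀)` for the lifted pair. -/
  leray : ∀ (U₀ U : ℝ³ → ℝ³) (P : ℝ³ → ℝ), ProfileHyp U₀ U P →
    IsLocalLeraySolution 1 U₀ (lerayForward (1 / 2) U) (lerayForwardPressure (1 / 2) P)

/-- The forward lift with rate `a = 1/2` restores the profile at `t = 1`: `lerayForward (1/2) U 1 = U`
(`2·(1/2)·1 = 1`). [folklore] -/
theorem lerayForward_half_one (U : ℝ³ → ℝ³) : lerayForward (1 / 2) U 1 = U := by
  have h := lerayForward_apply_inv (E := ℝ³) (a := (1 / 2 : ℝ)) (by norm_num) U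
  simpa using h

/-- **Assembly (kernel-checked modus ponens):** JS14 Theorem 6 (published) together with Lemma A (claim)
gives, for every profile satisfying IJP26's hypotheses, the full-order decay `|∂^α(U − e^ΔU₀)| ≲ (1+|x|)^{−3−|α|}`
— IJP26 (pot15.001) for all `α`. Exactly `Thm6` and `LemmaA` are consumed. [folklore] -/
theorem decay_of_thm6_lemmaA (hT : Thm6) (hA : LemmaA) {U₀ U : ℝ³ → ℝ³} {P : ℝ³ → ℝ}
    (h : ProfileHyp U₀ U P) : ProfileDecay U₀ U := by
  have hd := hT.profile U₀ (lerayForward (1 / 2) U) (lerayForwardPressure (1 / 2) P) h.datum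
    (hA.leray U₀ U P h) (isSelfSimilar_lerayForward _ _)
  have hfun : (fun x => lerayForward (1 / 2) U 1 x) = U := by
    funext x; rw [lerayForward_half_one]
  rwa [hfun] at hd

/-- The `|α| ≤ 2` case, which is what IJP26 §3 Step 1 (pot15.001) states. [folklore] -/
theorem decay_le_two_of_thm6_lemmaA (hT : Thm6) (hA : LemmaA) {U₀ U : ℝ³ → ℝ³} {P : ℝ³ → ℝ}
    (h : ProfileHyp U₀ U P) :
    ContDiff ℝ (⊤ : ℕ∞) U ∧ ∀ n : ℕ, n ≤ 2 → ∃ C : ℝ, ∀ x : ℝ³,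
      ‖iteratedFDeriv ℝ n (fun y => U y - heatExtension U₀ 1 y) x‖ ≤ C / (1 + ‖x‖) ^ (3 + n) :=
  ⟨(decay_of_thm6_lemmaA hT hA h).1, fun n _ => (decay_of_thm6_lemmaA hT hA h).2 n⟩

/-! ## The eigenfunction half of IJP26 §3 Step 1 (cell Lemma B, LEMMA-B.md, gen 6)

IJP26 (pot14) (TeX L695–703): for the eigenpair `(Ũ, λ)` of the linearised operator in similarity variables,
"`|∇^αŨ(x)| ≲ ⟨x⟩^{−3−|α|}`, `|α| ≤ 2`". The cell's Lemma B (LEMMA-B.md, pen-and-paper, NOT in print, NOT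
kernel-checked) proves the stronger `|Ũ| ≤ C⟨y⟩⁻⁴`, `|∇Ũ| ≤ C⟨y⟩⁻⁵`, `|∇²Ũ| ≤ C⟨y⟩⁻⁵` (LEMMA-B (0.1)) from JS14
Thm 6 (via Lemma A), the JS14 uniqueness lemma (TeX L806–843, part i)) and Lemarié-Rieusset 2016 Cor. 4.1/4.2.
Typed here as the claim structure `LemmaB`; the kernel-checked part is (i) `EigDecay.of_strong` ((0.1) ⇒ (pot14))
and (ii) the assembly `step1_of_thm6_lemmaA_lemmaB` recording exactly which named inputs IJP26 §3 Step 1 consumes.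
The eigen-equation is IJP26 (pr6) line 2 (TeX L176–178), `ΔŨ + ½y·∇Ũ + ½Ũ − Π(U·∇Ũ + Ũ·∇U) = λŨ`, with `Π F`
read as `F − ∇P̃` for a scalar pressure `P̃` (LEMMA-B H-E4), written COMPONENTWISE over `ℂ` (the field `Ũ` is
complex, the profile `U` real; `Ũ·∇U` is `Σⱼ Ũⱼ ∂ⱼU` with `∂ⱼU` complexified). Typing conveniences that make
the typed `LemmaB` WEAKER than the paper lemma (safe direction for a hypothesis structure): the pressure is
taken classical `C¹` and in some `L^q`, `3/2 < q < ∞` (LEMMA-B uses only the existence of a distribution `P̃`);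
`ProfileDecay U₀ U` (JS14 Thm 6's conclusion) is an explicit hypothesis rather than re-derived. -/

/-- File-local notation for the complex 3-vectors of the eigenfunction. -/
local notation "ℂ³" => EuclideanSpace ℂ (Fin 3)

/-- **Hypotheses on the eigenpair in IJP26 Thm. 1.2** (arXiv:2606.07501 p.4; LEMMA-B H-E2–H-E4) for a real
profile `U`, a complex field `V = Ũ`, a pressure `Q = P̃` and `μ = λ`: `Ũ ∈ C²`, `div Ũ = 0`, `|Ũ(y)| ≲ ⟨y⟩⁻²`,
`Re λ > 0`, `P̃ ∈ C¹ ∩ L^q` for some `3/2 < q < ∞`, and the eigen-equation, componentwise: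
`(ΔŨ)ᵢ + ½(y·∇Ũ)ᵢ + ½Ũᵢ − (U·∇Ũ)ᵢ − Σⱼ Ũⱼ ∂ⱼUᵢ − ∂ᵢP̃ = λ Ũᵢ`. Deliberately NO `Ũ ≠ 0` clause: Lemma B is a
decay statement, true for `Ũ = 0`; the non-triviality clause the printed IJP26 Thm. 1.2 omits (DIVERGENCE D12) is a
separate requirement on any instantiation and is not part of this structure. [cite: IonescuJiaPalasek2026, Thm. 1.2 p.4] -/
structure EigHyp (U : ℝ³ → ℝ³) (V : ℝ³ → ℂ³) (Q : ℝ³ → ℂ) (μ : ℂ) : Prop where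
  /-- `Ũ ∈ C²(ℝ³; ℂ³)` (as a map of the real variable `y`). -/
  contDiff_velocity : ContDiff ℝ 2 V
  /-- `P̃ ∈ C¹`. -/
  contDiff_pressure : ContDiff ℝ 1 Q
  /-- `div Ũ = Σᵢ ∂ᵢŨᵢ = 0`. -/
  divFree : ∀ y : ℝ³, ∑ i : Fin 3, fderiv ℝ V y (EuclideanSpace.single i 1) i = 0
  /-- "`|Ũ(y)| ≲ ⟨y⟩⁻²`". -/
  decay : ∃ C : ℝ, ∀ y : ℝ³, ‖V y‖ ≤ C / (1 + ‖y‖ ^ 2)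
  /-- "`Re λ > 0`" (JS sign: unstable). -/
  unstable : 0 < μ.re
  /-- `P̃ ∈ L^q(ℝ³)` for some `3/2 < q < ∞`. -/
  pressure_Lq : ∃ q : ℝ≥0∞, 3 / 2 < q ∧ q < (⊤ : ℝ≥0∞) ∧ MemLp Q q volume
  /-- The eigen-equation IJP26 (pr6) line 2, componentwise over `ℂ`. -/
  eigen : ∀ (y : ℝ³) (i : Fin 3),
    (Δ V) y i + (1 / 2 : ℂ) * fderiv ℝ V y y i + (1 / 2 : ℂ) * V y i
      - fderiv ℝ V y (U y) i
      - ∑ j : Fin 3, V y j * ((fderiv ℝ U y (EuclideanSpace.single j 1)) i : ℂ)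
      - fderiv ℝ Q y (EuclideanSpace.single i 1) = μ * V y i

/-- **IJP26 (pot14)** (TeX L695–703): "`|∇^αŨ(x)| ≲ ⟨x⟩^{−3−|α|}`, `|α| ≤ 2`", with `iteratedFDeriv ℝ n` and the
natural-number power `(1 + ‖x‖)^(3+n)`. [cite: IonescuJiaPalasek2026, §3 (pot14)] -/
def EigDecay (V : ℝ³ → ℂ³) : Prop :=
  ∀ n : ℕ, n ≤ 2 → ∃ C : ℝ, ∀ x : ℝ³, ‖iteratedFDeriv ℝ n V x‖ ≤ C / (1 + ‖x‖) ^ (3 + n)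

/-- **LEMMA-B (0.1)**: `|Ũ| ≤ C⟨y⟩⁻⁴`, `|∇Ũ| ≤ C⟨y⟩⁻⁵`, `|∇²Ũ| ≤ C⟨y⟩⁻⁵`, with `⟨y⟩` replaced by the comparable
`1 + ‖y‖`. The order-`0` rate `4` is sharp in general (LEMMA-B §5.2, the far-field dipole of the Riesz pressure).
The conclusion of a cell lemma, not a printed statement; the printed one is `EigDecay`. [folklore] -/
def EigDecayStrong (V : ℝ³ → ℂ³) : Prop :=
  (∃ C : ℝ, ∀ x : ℝ³, ‖V x‖ ≤ C / (1 + ‖x‖) ^ 4) ∧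
  (∃ C : ℝ, ∀ x : ℝ³, ‖iteratedFDeriv ℝ 1 V x‖ ≤ C / (1 + ‖x‖) ^ 5) ∧
  (∃ C : ℝ, ∀ x : ℝ³, ‖iteratedFDeriv ℝ 2 V x‖ ≤ C / (1 + ‖x‖) ^ 5)

/-- A bound `‖f x‖ ≤ C/(1+‖x‖)^m` weakens to exponent `k ≤ m` (with the constant `|C|`). [folklore] -/
theorem decay_pow_mono {F : Type*} [NormedAddCommGroup F] (f : ℝ³ → F) {C : ℝ} {k m : ℕ} (hkm : k ≤ m)
    (h : ∀ x : ℝ³, ‖f x‖ ≤ C / (1 + ‖x‖) ^ m) : ∀ x : ℝ³, ‖f x‖ ≤ |C| / (1 + ‖x‖) ^ k := by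
  intro x
  have h1 : (1 : ℝ) ≤ 1 + ‖x‖ := by linarith [norm_nonneg x]
  have hk : (0 : ℝ) < (1 + ‖x‖) ^ k := pow_pos (by linarith) k
  have hpow : (1 + ‖x‖) ^ k ≤ (1 + ‖x‖) ^ m := pow_le_pow_right₀ h1 hkm
  calc ‖f x‖ ≤ C / (1 + ‖x‖) ^ m := h x
    _ ≤ |C| / (1 + ‖x‖) ^ m := by
        gcongr
        exact le_abs_self C
    _ ≤ |C| / (1 + ‖x‖) ^ k := by
        gcongr

/-- **(0.1) ⇒ (pot14), kernel-checked**: LEMMA-B's rates `4, 5, 5` contain IJP26's `3, 4, 5`. [folklore] -/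
theorem EigDecay.of_strong {V : ℝ³ → ℂ³} (h : EigDecayStrong V) : EigDecay V := by
  intro n hn
  obtain ⟨⟨C₀, h₀⟩, ⟨C₁, h₁⟩, ⟨C₂, h₂⟩⟩ := h
  interval_cases n
  · refine ⟨|C₀|, ?_⟩
    have h₀' : ∀ x : ℝ³, ‖iteratedFDeriv ℝ 0 V x‖ ≤ C₀ / (1 + ‖x‖) ^ 4 := by
      intro x; rw [norm_iteratedFDeriv_zero]; exact h₀ x
    simpa using decay_pow_mono (fun x => iteratedFDeriv ℝ 0 V x) (by norm_num : 3 ≤ 4) h₀'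
  · exact ⟨|C₁|, by simpa using decay_pow_mono (fun x => iteratedFDeriv ℝ 1 V x) (by norm_num : 4 ≤ 5) h₁⟩
  · exact ⟨|C₂|, by simpa using decay_pow_mono (fun x => iteratedFDeriv ℝ 2 V x) le_rfl h₂⟩

/-- **Lemma B of cell pub-nsjs (LEMMA-B.md, gen 6) — a CLAIM, not a fact.** For a profile `(U₀, U, P)` with
IJP26's hypotheses and JS14 Thm 6's decay (`ProfileDecay U₀ U`, hence `|∂^αU| ≲ ⟨y⟩^{−1−|α|}`, LEMMA-B (1.1)), every
eigenpair `(Ũ, P̃, λ)` with `EigHyp` satisfies LEMMA-B (0.1). Proof: parabolic lift `h = t^{−1/2+λ}Ũ(x/√t)`, mild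
representation forced by JS14's uniqueness lemma part i) (TeX L836–843, applied to `f = 0`), Oseen-kernel bounds
(Lemarié-Rieusset 2016 Cor. 4.2) and a five-step decay bootstrap; `Re λ > 0` enters only through
`∫₀¹ s^{−1+Re λ} ds < ∞`. NOT in print, NOT kernel-checked; a hypothesis STRUCTURE — never an instance, never an
axiom; consumers take `(hB : LemmaB)` explicitly. Status: cell-internal lemma under audit by the cell's referees,
filed under the tree's claim tag for unrefereed material. [claim: IonescuJiaPalasek2026, status: under-review] -/
structure LemmaB : Prop where
  /-- (0.1) for every eigenpair of the class. -/
  decay : ∀ (U₀ U : ℝ³ → ℝ³) (P : ℝ³ → ℝ) (V : ℝ³ → ℂ³) (Q : ℝ³ → ℂ) (μ : ℂ),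
    ProfileHyp U₀ U P → ProfileDecay U₀ U → EigHyp U V Q μ → EigDecayStrong V

/-- **Assembly of IJP26 §3 Step 1 (kernel-checked modus ponens):** JS14 Thm 6 (published fact) + Lemma A (claim)
+ Lemma B (claim) give, for every profile with IJP26's hypotheses and every eigenpair of IJP26's class, both
displays (pot15.001) (all orders) and (pot14). Exactly `Thm6`, `LemmaA`, `LemmaB` are consumed. [folklore] -/
theorem step1_of_thm6_lemmaA_lemmaB (hT : Thm6) (hA : LemmaA) (hB : LemmaB) {U₀ U : ℝ³ → ℝ³} {P : ℝ³ → ℝ}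
    {V : ℝ³ → ℂ³} {Q : ℝ³ → ℂ} {μ : ℂ} (h : ProfileHyp U₀ U P) (hE : EigHyp U V Q μ) :
    ProfileDecay U₀ U ∧ EigDecay V :=
  ⟨decay_of_thm6_lemmaA hT hA h,
    EigDecay.of_strong (hB.decay U₀ U P V Q μ h (decay_of_thm6_lemmaA hT hA h) hE)⟩

end Literature.Analysis.FluidPDE.JiaSverak2014
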